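import Summits.QuantumFields.YangMills.Theses.ConvexGribovBody
import Summits.QuantumFields.YangMills.Theses.CertificationLength
import Summits.QuantumFields.YangMills.Theses.OneCertifiedCube
import Summits.QuantumFields.YangMills.Theorems.OneCertifiedCubeFiniteSizeCriterion
import HarnessLib

/-!
# Crux `NonSimplyConnectedLatticeGap` (stmt-QuantumFields-16405) — crux-ideate sketch, ideator 1, round 1

First lemmas of the two crux idea cards filed by `planner-cruxidea-stmt-QuantumFields-16405-1-0`:

* card `sectors-are-boundary-conditions` (CA/box funnel):
  `nonSimplyConnectedLatticeGap_of_completeAnalyticity` — the crux follows from item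
  stmt-QuantumFields-16178 (`CertificationLength.CompleteAnalyticityAtLargeScales`) through the PROVED
  engine stmt-QuantumFields-8895 (`OneCertifiedCube.FiniteSizeCriterion`, `FiniteSizeCriterion_proof`);
  `BoxFiniteSizeCriterion` / `BoxAnalyticityAtLargeScalesNSC` — the box-restricted transfer target C⁺
  (Dobrushin–Shlosman finite-size condition over BOX volumes only, where `H²(V,∂V;π₁G) = H₂(box) = 0`:
  no 't Hooft flux sector exists anywhere in the line), with `nonSimplyConnectedLatticeGap_of_box`
  (funnel, proved) and `boxAnalyticityNSC_of_completeAnalyticity` (C⁺ is implied by item 16178, proved).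
* card `twist-equipartition-blindness` (route-native sector line): the exact sector bookkeeping
  identity `cov_eq_sum_sectorCov_add_sectorSpread` (statement only).
-/

open MeasureTheory
open Literature.MathematicalPhysics.QuantumFieldTheory Literature.MathematicalPhysics.QuantumLattice
open Summit.QuantumFields.YangMills.Theses

namespace Summit.QuantumFields.YangMills.Cruxes.NonSimplyConnectedLatticeGap.Sketch

/-! ## Card 1 — sectors are boundary conditions -/

/-- **CA funnel.** Complete analyticity at large scales (item 16178, all compact simple `G`) and the
finite-size criterion (item 8895, proved) imply the crux; `¬ SimplyConnectedSpace G` is not even used: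
the same term proves `ConvexGribovBody.UniformLatticeGap`. Rate `m(β) = κ(n,ε)/b(β)`,
`S₁(β) = (8n+7) b(β)`, `C = C(A,B)` independent of `β`. -/
theorem nonSimplyConnectedLatticeGap_of_completeAnalyticity
    (hA : CertificationLength.CompleteAnalyticityAtLargeScales)
    (hF : OneCertifiedCube.FiniteSizeCriterion) :
    ConvexGribovBody.NonSimplyConnectedLatticeGap := by
  intro G _ _ _ _ iM iB hG _ r
  have hM : iM = borel G := BorelSpace.measurable_eq
  subst hM
  letI : MeasurableSpace G := borel G
  obtain ⟨n, ε, hn, hε, hεM, hB⟩ := hA G hG r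
  obtain ⟨κ, hκ, hAll⟩ := hF n ε hn hε hεM
  obtain ⟨β₂, hβ₂⟩ := hB 1
  refine ⟨β₂, fun β hβ => ?_⟩
  obtain ⟨b, -, hb1, hTV⟩ := hβ₂ β hβ
  have hb0 : (0 : ℝ) < (b : ℝ) := by exact_mod_cast (show 0 < b by omega)
  refine ⟨κ / b, div_pos hκ hb0, (8 * n + 7) * b, fun A B => ?_⟩
  obtain ⟨C, hC⟩ := hAll G r.N r.ρ r.continuous r.injective A B
  refine ⟨C, fun S t hS ht => ?_⟩
  have h2S : (8 * n + 7) * b ≤ 2 * S + 1 :=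
    hS.trans ((Nat.le_mul_of_pos_left S (by norm_num)).trans (Nat.le_succ _))
  have h := hC β b hb1 hTV S h2S t ht
  rw [div_mul_eq_mul_div]
  exact h

/-- The crux modulo item 16178 alone (the engine is the tree's `FiniteSizeCriterion_proof`). -/
theorem nonSimplyConnectedLatticeGap_of_completeAnalyticity'
    (hA : CertificationLength.CompleteAnalyticityAtLargeScales) :
    ConvexGribovBody.NonSimplyConnectedLatticeGap :=
  nonSimplyConnectedLatticeGap_of_completeAnalyticity hA
    Summit.QuantumFields.YangMills.Theorems.FiniteSizeCriterion_proof

/-- **Box-restricted finite-size criterion** (stub of the line; provable grade — the proof of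
`FiniteSizeCriterion_proof` never leaves a cube-stable class of cell unions: the recursion uses the
volume `Λ` itself and `Λ ∩ cube`, and the torus step uses a box): verbatim `OneCertifiedCube.FiniteSizeCriterion`
with the cell-union volumes `Y` restricted to BOXES `∏ᵢ [loᵢ, hiᵢ]` of cells containing the central cell. -/
def BoxFiniteSizeCriterion : Prop :=
  ∀ (n : ℕ) (ε : ℝ), 1 ≤ n → 0 ≤ ε → ε * ((((4 * n + 3) ^ 4 - (4 * n + 1) ^ 4 : ℕ)) : ℝ) < 1 → ∃ κ : ℝ, 0 < κ ∧ ∀ (G : Type) [Group G] [TopologicalSpace G] [IsTopologicalGroup G] [CompactSpace G] [MeasurableSpace G] [BorelSpace G] (N : ℕ) (ρ : G →* Matrix (Fin N) (Fin N) ℂ), Continuous ρ → Function.Injective ρ → ∀ A B : Literature.MathematicalPhysics.QuantumLattice.LocalGaugeObservable 4 G, ∃ C : ℝ, ∀ (β : ℝ) (b : ℕ), 1 ≤ b → (∀ w : Fin 4 → ℤ → ℤ, (∀ i j, w i j + ((b : ℕ) : ℤ) ≤ w i (j + 1) ∧ w i (j + 1) ≤ w i j + 2 * ((b : ℕ) :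 ℤ)) → ∀ lo hi : Fin 4 → ℤ, (∀ i, -(2 * ((n : ℕ) : ℤ)) ≤ lo i ∧ lo i ≤ 0 ∧ 0 ≤ hi i ∧ hi i ≤ 2 * ((n : ℕ) : ℤ)) → let Y : Finset (Fin 4 → ℤ) := Fintype.piFinset fun i : Fin 4 => Finset.Icc (lo i) (hi i); ∀ η η' : Literature.MathematicalPhysics.QuantumLattice.LGConfig 4 G, (∀ e ∈ (Fintype.piFinset fun _ : Fin 4 => Finset.Icc (-(2 * ((n : ℕ) : ℤ))) (2 * ((n : ℕ) : ℤ))).biUnion (fun y : Fin 4 → ℤ => (Fintype.piFinset fun i : Fin 4 => Finset.Ico (w i (y i)) (w i (y i + 1))) ×ˢ (Finset.univ : Finset (Fin 4))), η e = η' e) → ∀ f : Literature.MathematicalPhysics.QuantumLattice.LGConfig 4 G → ℝ, Literature.MathematicalPhysics.QuantumLattice.IsCylinder f ((fun y : Fin 4 → ℤ => (Fintype.piFinset fun i : Fin 4 => Finset.Ico (w i (y i)) (w i (y i + 1))) ×ˢ (Finset.univ : Finset (Fin 4))) 0) → Measurable f → (∀ U, 0 ≤ f U ∧ f U ≤ 1)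 → |(∫ U, f U ∂(Literature.MathematicalPhysics.QuantumLattice.ymSpecification ρ β (Y.biUnion (fun y : Fin 4 → ℤ => (Fintype.piFinset fun i : Fin 4 => Finset.Ico (w i (y i)) (w i (y i + 1))) ×ˢ (Finset.univ : Finset (Fin 4)))) η)) - ∫ U, f U ∂(Literature.MathematicalPhysics.QuantumLattice.ymSpecification ρ β (Y.biUnion (fun y : Fin 4 → ℤ => (Fintype.piFinset fun i : Fin 4 => Finset.Ico (w i (y i)) (w i (y i + 1))) ×ˢ (Finset.univ : Finset (Fin 4)))) η')| ≤ ε) → ∀ S : ℕ, (8 * n + 7) * b ≤ 2 * S + 1 → ∀ t : ℕ, t ≤ S → |Literature.MathematicalPhysics.QuantumFieldTheory.latticeConnectedCorr ρ β (2 * S + 1) A.F B.F t| ≤ C * Real.exp (-(κ * t / b))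

/-- **C⁺ of card 1: box analyticity at large scales for the non-simply-connected groups** — verbatim
`CertificationLength.CompleteAnalyticityAtLargeScales` (item 16178) restricted to `¬ SimplyConnectedSpace G`
and to BOX volumes. Boxes with Dirichlet exterior carry no 't Hooft flux sector
(`H²(V, ∂V; π₁G) ≅ H₂(V; π₁G) = 0`), so the slice-bottleneck mechanism that created this crux has no
analogue for C⁺. -/
def BoxAnalyticityAtLargeScalesNSC : Prop :=
  open Literature.MathematicalPhysics.QuantumLattice Literature.MathematicalPhysics.AQFT Literature.MathematicalPhysics.QuantumFieldTheory in ∀ (G : Type) [Group G] [TopologicalSpace G] [IsTopologicalGroup G] [CompactSpace G], IsCompactSimpleLieGroup G → ¬ SimplyConnectedSpace G → letI : MeasurableSpace G := borel G; haveI : BorelSpace G := ⟨rfl⟩; ∀ r : LatticeRep G, ∃ (n : ℕ) (ε : ℝ), 1 ≤ n ∧ 0 ≤ ε ∧ ε * ((((4 * n + 3) ^ 4 - (4 * n + 1) ^ 4 : ℕ)) : ℝ) < 1 ∧ ∀ B : ℕ, ∃ β₂ : ℝ, ∀ β : ℝ, β₂ ≤ β → ∃ b : ℕ, B ≤ b ∧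 1 ≤ b ∧ (∀ w : Fin 4 → ℤ → ℤ, (∀ i j, w i j + ((b : ℕ) : ℤ) ≤ w i (j + 1) ∧ w i (j + 1) ≤ w i j + 2 * ((b : ℕ) : ℤ)) → ∀ lo hi : Fin 4 → ℤ, (∀ i, -(2 * ((n : ℕ) : ℤ)) ≤ lo i ∧ lo i ≤ 0 ∧ 0 ≤ hi i ∧ hi i ≤ 2 * ((n : ℕ) : ℤ)) → let Y : Finset (Fin 4 → ℤ) := Fintype.piFinset fun i : Fin 4 => Finset.Icc (lo i) (hi i); ∀ η η' : LGConfig 4 G, (∀ e ∈ (Fintype.piFinset fun _ : Fin 4 => Finset.Icc (-(2 * ((n : ℕ) : ℤ))) (2 * ((n : ℕ) : ℤ))).biUnion (fun y : Fin 4 → ℤ => (Fintype.piFinset fun i : Fin 4 => Finset.Ico (w i (y i)) (w i (y i + 1))) ×ˢ (Finset.univ : Finset (Fin 4))), η e = η' e) → ∀ f : LGConfig 4 G → ℝ, IsCylinder f ((fun y : Fin 4 → ℤ => (Fintype.piFinset fun i : Fin 4 => Finset.Ico (w i (y i)) (w i (y i + 1))) ×ˢ (Finset.univ : Finset (Fin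 4))) 0) → Measurable f → (∀ U, 0 ≤ f U ∧ f U ≤ 1) → |(∫ U, f U ∂(ymSpecification r.ρ β (Y.biUnion (fun y : Fin 4 → ℤ => (Fintype.piFinset fun i : Fin 4 => Finset.Ico (w i (y i)) (w i (y i + 1))) ×ˢ (Finset.univ : Finset (Fin 4)))) η)) - ∫ U, f U ∂(ymSpecification r.ρ β (Y.biUnion (fun y : Fin 4 → ℤ => (Fintype.piFinset fun i : Fin 4 => Finset.Ico (w i (y i)) (w i (y i + 1))) ×ˢ (Finset.univ : Finset (Fin 4)))) η')| ≤ ε)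

/-- **Box funnel**: the box engine and C⁺ give the crux (same bookkeeping as the CA funnel). -/
theorem nonSimplyConnectedLatticeGap_of_box
    (hF : BoxFiniteSizeCriterion) (hA : BoxAnalyticityAtLargeScalesNSC) :
    ConvexGribovBody.NonSimplyConnectedLatticeGap := by
  intro G _ _ _ _ iM iB hG hnsc r
  have hM : iM = borel G := BorelSpace.measurable_eq
  subst hM
  letI : MeasurableSpace G := borel G
  obtain ⟨n, ε, hn, hε, hεM, hB⟩ := hA G hG hnsc r
  obtain ⟨κ, hκ, hAll⟩ := hF n ε hn hε hεM
  obtain ⟨β₂, hβ₂⟩ := hB 1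
  refine ⟨β₂, fun β hβ => ?_⟩
  obtain ⟨b, -, hb1, hTV⟩ := hβ₂ β hβ
  have hb0 : (0 : ℝ) < (b : ℝ) := by exact_mod_cast (show 0 < b by omega)
  refine ⟨κ / b, div_pos hκ hb0, (8 * n + 7) * b, fun A B => ?_⟩
  obtain ⟨C, hC⟩ := hAll G r.N r.ρ r.continuous r.injective A B
  refine ⟨C, fun S t hS ht => ?_⟩
  have h2S : (8 * n + 7) * b ≤ 2 * S + 1 :=
    hS.trans ((Nat.le_mul_of_pos_left S (by norm_num)).trans (Nat.le_succ _))
  have h := hC β b hb1 hTV S h2S t ht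
  rw [div_mul_eq_mul_div]
  exact h

/-- **C⁺ is implied by the existing item 16178** (boxes are cell unions in the cube containing `0`). -/
theorem boxAnalyticityNSC_of_completeAnalyticity
    (hA : CertificationLength.CompleteAnalyticityAtLargeScales) :
    BoxAnalyticityAtLargeScalesNSC := by
  intro G _ _ _ _ hG _ r
  obtain ⟨n, ε, hn, hε, hεM, hB⟩ := hA G hG r
  refine ⟨n, ε, hn, hε, hεM, fun B => ?_⟩
  obtain ⟨β₂, h⟩ := hB B
  refine ⟨β₂, fun β hβ => ?_⟩
  obtain ⟨b, hBb, hb1, hTV⟩ := h β hβ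
  refine ⟨b, hBb, hb1, fun w hw lo hi hlohi => ?_⟩
  intro Y η η' hagree f hf hfm hf01
  refine hTV w hw Y ?_ ?_ η η' hagree f hf hfm hf01
  · exact Fintype.piFinset_subset _ _ fun i => Finset.Icc_subset_Icc (hlohi i).1 (hlohi i).2.2.2
  · refine Fintype.mem_piFinset.2 fun i => ?_
    simp only [Pi.zero_apply, Finset.mem_Icc]
    exact ⟨(hlohi i).2.1, (hlohi i).2.2.1⟩

/-! ## Card 2 — twist equipartition ⇒ blindness; sector bookkeeping identity -/

/-- **Exact sector bookkeeping** (card 2, step (i)): for a finite measurable partition `E` of a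
probability space, `Cov(A,B) = Σ_k p_k Cov_k(A,B) + ½ Σ_{k,k'} p_k p_{k'} (a_k − a_{k'})(b_k − b_{k'})`,
written with `p_k = μ(E_k)`, `I_k(F) = ∫_{E_k} F` and `a_k = I_k(A)/p_k` (junk-safe: a null part
contributes `0` on both sides). With `E` the 4-d 't Hooft class of a Wilson configuration (plus the
bad event as one more part), `A` local and `B = τ_n B'`, the second sum is the `n`-INDEPENDENT
sector-spread term that forces sector-blindness at rate `e^{-mS}`; the card derives it from twist
equipartition. Statement only. -/
theorem cov_eq_sum_sectorCov_add_sectorSpread {Ω : Type*} [MeasurableSpace Ω] (μ : Measure Ω)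
    [IsProbabilityMeasure μ] {K : Type*} [Fintype K] (E : K → Set Ω)
    (hE : ∀ k, MeasurableSet (E k)) (hdisj : Pairwise (Function.onFun Disjoint E))
    (hcover : (⋃ k, E k) = Set.univ)
    (A B : Ω → ℝ) (hA : Integrable A μ) (hB : Integrable B μ)
    (hAB : Integrable (fun ω => A ω * B ω) μ) :
    (∫ ω, A ω * B ω ∂μ) - (∫ ω, A ω ∂μ) * (∫ ω, B ω ∂μ) =
      (∑ k, ((∫ ω in E k, A ω * B ω ∂μ) -
          ((μ (E k)).toReal)⁻¹ * (∫ ω in E k, A ω ∂μ) * (∫ ω in E k, B ω ∂μ))) +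
      (1 / 2) * ∑ k, ∑ k', ((μ (E k)).toReal)⁻¹ * ((μ (E k')).toReal)⁻¹ *
          (((μ (E k')).toReal * ∫ ω in E k, A ω ∂μ) - (μ (E k)).toReal * ∫ ω in E k', A ω ∂μ) *
          (((μ (E k')).toReal * ∫ ω in E k, B ω ∂μ) - (μ (E k)).toReal * ∫ ω in E k', B ω ∂μ) := by
  sorry

end Summit.QuantumFields.YangMills.Cruxes.NonSimplyConnectedLatticeGap.Sketch
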